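import Literature.Topology.FourManifolds.SphereSurgeryOrientation
import Literature.Topology.FourManifolds.ClosedModelRelOrientation
import Literature.AlgebraicTopology.SingularHomology.BoundaryClassNaturality
import HarnessLib

/-!
# Surgery preserves the orientation LOCALLY: the natural orientation of `χ(W, φ)` off the handle

Topic `Literature/Topology/FourManifolds` (fact seat of
`Literature.Topology.FourManifolds.HomotopySphere.exists_highlyConnected_of_mem_signatureSet`,
brick B6b).  J. Milnor, *Lectures on the h-cobordism theorem* (1965), §3 p. 21 and
M. Kervaire, J. Milnor, *Groups of homotopy spheres I*, Ann. of Math. 77 (1963), §5: the manifold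
`χ(W, φ)` obtained from an oriented `W` by surgery on an interior framed sphere carries "a natural
orientation", namely the one which AGREES WITH THAT OF `W` on the common open piece
`W ∖ S ⊆ W, χ(W, φ)`; in particular the oriented boundary is unchanged, `bχ(W, φ) = bW` as
oriented manifolds.  `SphereSurgeryOrientation.lean` (brick B7b) produced SOME relative
fundamental class of `χ(W, φ)`; this file records the sharper, local statement needed to compare
fundamental classes (and signatures) before and after the surgery:

* `NullCobordism.exists_isRelFundamentalClass_of_piece_of_orientation_local` — the gluing of
  `[W_S, ∂W_S]|_{piece}` with an orientation of an open oriented handle (as in B7b) yields a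
  relative fundamental class `w_U` of `(W_U, ∂W_U)` **whose local classes over the piece are the
  transported local classes of `w_S`**: `w_U|_{j x} = j_* (w_S|_x)`;
* `NullCobordism.exists_isRelFundamentalClass_surgery_local` — for the surgery
  `χ = (W ∖ S) ∪ OD^{k+1} × Sˡ` (`k ≥ 1`, `l ≥ 2`): from a relative fundamental class `w` of
  `(W, ∂W)`, a relative fundamental class `w'` of `(χ, ∂χ)` with `w'|_{inl a} = inl_* (w|_a)` at
  every interior point `a ∈ W ∖ S`;
* `NullCobordism.boundaryOrientation_comap_eq_of_local` — **the oriented boundary is unchanged**: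
  if `∂w = incl_* [M]_μ` then the boundary orientation of `∂w'` (moved to `M` along
  `incl' = inl ∘ incl`) is `μ` — boundary local classes are local and natural in open
  embeddings of pairs (Hatcher 2002 p. 254; tree `toLocal_δ_eq_of_two_embeddings_manifold`),
  and two orientations of `M` agree iff their local classes do (`HomologicalOrientation.ext`);
* `NullCobordism.exists_isOrientedBy_surgery_local` — **oriented-boundary data pass through the
  surgery with a locally matching fundamental class**: from `c.IsOrientedBy μ μ'` one gets `w`,
  `w'`, `μ''` with `[Ŵ]_{μ'} = c_w`, `[χ̂]_{μ''} = c_{w'}`, `(c.surgery ν hkl).IsOrientedBy μ μ''`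
  and the local agreement of `w`, `w'` over `W ∖ S`.

Everything is proved; no definitions, no named facts.

## References

* J. Milnor, *Lectures on the h-cobordism theorem* (1965), Def. 3.11, §3 p. 21.
  [MilnorHCobordism1965]
* M. Kervaire, J. Milnor, *Groups of homotopy spheres I*, Ann. of Math. 77 (1963), §5, §7.
  [KervaireMilnorAnnals1963]
* A. Hatcher, *Algebraic Topology* (2002), §3.3 p. 253–254, Lemma 3.27, Thm. 3.26.
  [HatcherAT2002]
-/

noncomputable section

open scoped Manifold ContDiff Topology
open Set Function Filter CategoryTheory Limits Topology
open Literature.AlgebraicTopology.SingularHomology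

namespace Literature.Topology.FourManifolds

namespace NullCobordism

variable {m : ℕ}
variable {MU : Type} [TopologicalSpace MU] [ChartedSpace (EuclideanSpace ℝ (Fin (m + 1))) MU]
  [IsManifold (𝓡 (m + 1)) ∞ MU] [CompactSpace MU]

/-! ### §1 Gluing with local control over the piece -/

section Gluing

variable {MS : Type} [TopologicalSpace MS] [ChartedSpace (EuclideanSpace ℝ (Fin (m + 1))) MS]
  [IsManifold (𝓡 (m + 1)) ∞ MS] [CompactSpace MS]
variable {cS : NullCobordism (m + 1) MS} {cU : NullCobordism (m + 1) MU}

/-- **Gluing `[W_S, ∂W_S]` with an orientation of an open oriented piece, with local control**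
(Hatcher 2002, p. 253, Lemma 3.27; Milnor 1965, §3 p. 21): as in
`exists_isRelFundamentalClass_of_piece_of_orientation`, and moreover the local class of the glued
relative fundamental class `w_U` at `j x`, for `x` an interior point of the piece, is the
transported local class `j_* (w_S|_x)` (`j_* (pieceClass w_S x)`).
[cite: HatcherAT2002, §3.3 p. 253, Lemma 3.27] -/
theorem exists_isRelFundamentalClass_of_piece_of_orientation_local (S : Piece cS cU) {B : Type}
    [TopologicalSpace B] [LocallyCompactSpace B] (jT : C(B, cU.W)) (hjT : IsOpenEmbedding jT)
    (hint : ∀ b, jT b ∈ (𝓡∂ (m + 1 + 1)).interior cU.W)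
    (μB : HomologicalOrientation ℤ B (m + 1 + 1)) (hcov : range S.j ∪ range jT = univ)
    (hne : {v : cU.Interior | v.val ∈ range S.j ∩ range jT}.Nonempty)
    (hpre : IsPreconnected {v : cU.Interior | v.val ∈ range S.j ∩ range jT})
    {wS : relativeSingularHomology ℤ ℤ cS.W ((𝓡∂ (m + 1 + 1)).boundary cS.W) (m + 1 + 1)}
    (hwS : IsRelFundamentalClass ℤ ((𝓡∂ (m + 1 + 1)).boundary cS.W) wS) :
    ∃ wU : relativeSingularHomology ℤ ℤ cU.W ((𝓡∂ (m + 1 + 1)).boundary cU.W) (m + 1 + 1),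
      IsRelFundamentalClass ℤ ((𝓡∂ (m + 1 + 1)).boundary cU.W) wU ∧
      ∀ (x : S.A) (hx : (x : cS.W) ∈ (𝓡∂ (m + 1 + 1)).interior cS.W),
        relativeSingularHomology.toLocal ℤ ℤ ((𝓡∂ (m + 1 + 1)).boundary cU.W)
            ⟨S.j x, S.j_mem_compl_boundary (cS.not_mem_boundary_of_mem_interior hx)⟩ (m + 1 + 1) wU =
          relativeSingularHomology.map ℤ ℤ S.j (LocalFamily.mapsTo_compl_pt S.j_injective x)
            (m + 1 + 1) (S.pieceClass wS x) := by
  classical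
  set O : Set cU.Interior := {v : cU.Interior | v.val ∈ range S.j ∩ range jT} with hO
  have hOopen : IsOpen O :=
    (S.isOpenEmbedding_j.isOpen_range.inter hjT.isOpen_range).preimage
      InteriorManifold.continuous_val
  set νS := S.interiorFamily wS with hνS
  set νT := handleInteriorFamily cU jT hjT μB with hνT
  have genS : ∀ v : cU.Interior, v.val ∈ range S.j →
      ∃ e : localHomology ℤ ℤ cU.Interior v (m + 1 + 1) ≃ₗ[ℤ] ℤ, e (νS v) = 1 := by
    rintro v ⟨x, hx⟩
    have hxint := BCSGluing.mem_interior_of_j_eq S hx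
    rw [← ModelWithCorners.compl_boundary] at hxint
    exact S.isGenerator_interiorFamily hwS x hxint v hx.symm
  have genT : ∀ v : cU.Interior, v.val ∈ range jT →
      ∃ e : localHomology ℤ ℤ cU.Interior v (m + 1 + 1) ≃ₗ[ℤ] ℤ, e (νT v) = 1 := by
    rintro v ⟨b, hb⟩
    exact isGenerator_handleInteriorFamily cU jT hjT μB b v hb.symm
  have consS : ∀ v : cU.Interior, v.val ∈ range S.j → ∃ N ∈ 𝓝 v, νS.ConsistentOn N := by
    rintro v ⟨x, hx⟩
    exact S.consistentOn_interiorFamily_nhds wS x (BCSGluing.mem_interior_of_j_eq S hx) v hx.symm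
  have consT : ∀ v : cU.Interior, v.val ∈ range jT → ∃ N ∈ 𝓝 v, νT.ConsistentOn N := by
    rintro v ⟨b, hb⟩
    exact consistentOn_handleInteriorFamily_nhds cU jT hjT μB hint b v hb.symm
  -- the sign function on the overlap and its constancy
  have hsign := fun (v : cU.Interior) (hv : v ∈ O) =>
    exists_units_smul_of_generators (genS v hv.1) (genT v hv.2)
  choose! εf hεf using hsign
  obtain ⟨v₀, hv₀⟩ := hne
  set ε : ℤˣ := εf v₀ with hε
  have hεconst : ∀ v ∈ O, εf v = ε := fun v hv =>
    LocalFamily.sign_eq_of_isPreconnected (EuclideanSpace ℝ (Fin (m + 1 + 1))) (β := νT) (β' := νS)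
      hOopen hpre (fun u hu => consT u hu.2) (fun u hu => consS u hu.1)
      (fun u hu => genT u hu.2) (ε := εf)
      (fun u hu => (hεf u hu).trans (Int.cast_smul_eq_zsmul ℤ (εf u : ℤ) (νT u)).symm) hv hv₀
  -- the glued family
  let β : LocalFamily ℤ ℤ cU.Interior (m + 1 + 1) := fun v =>
    if v.val ∈ range S.j then νS v else (ε : ℤ) • νT v
  have hβS : ∀ v : cU.Interior, v.val ∈ range S.j → β v = νS v := fun v hv => if_pos hv
  have hβT : ∀ v : cU.Interior, v.val ∈ range jT → β v = (ε : ℤ) • νT v := by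
    intro v hvT
    by_cases hvS : v.val ∈ range S.j
    · rw [hβS v hvS, hεf v ⟨hvS, hvT⟩, hεconst v ⟨hvS, hvT⟩]
    · exact if_neg hvS
  have hcover : ∀ v : cU.Interior, v.val ∈ range S.j ∨ v.val ∈ range jT := fun v => by
    have : v.val ∈ range S.j ∪ range jT := by rw [hcov]; exact mem_univ _
    exact this
  have hgen : ∀ v, ∃ e : localHomology ℤ ℤ cU.Interior v (m + 1 + 1) ≃ₗ[ℤ] ℤ, e (β v) = 1 := by
    intro v
    rcases hcover v with hvS | hvT
    · rw [hβS v hvS]; exact genS v hvS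
    · rw [hβT v hvT]; exact SmoothOrientation.exists_linearEquiv_units_smul (genT v hvT) ε
  have hcons : ∀ v, ∃ N ∈ 𝓝 v, LocalFamily.ConsistentOn β N := by
    intro v
    by_cases hvS : v.val ∈ range S.j
    · obtain ⟨N, hN, mN, hmN⟩ := consS v hvS
      have hOS : InteriorManifold.val ⁻¹' range S.j ∈ 𝓝 v :=
        (S.isOpenEmbedding_j.isOpen_range.preimage InteriorManifold.continuous_val).mem_nhds hvS
      refine ⟨N ∩ InteriorManifold.val ⁻¹' range S.j, Filter.inter_mem hN hOS,
        restrictLocal ℤ ℤ inter_subset_left _ mN, fun u hu => ?_⟩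
      rw [restrictToPoint_restrictLocal_apply, hmN u hu.1, hβS u hu.2]
    · have hvT : v.val ∈ range jT := (hcover v).resolve_left hvS
      obtain ⟨N, hN, mN, hmN⟩ := consT v hvT
      have hOT : InteriorManifold.val ⁻¹' range jT ∈ 𝓝 v :=
        (hjT.isOpen_range.preimage InteriorManifold.continuous_val).mem_nhds hvT
      refine ⟨N ∩ InteriorManifold.val ⁻¹' range jT, Filter.inter_mem hN hOT,
        (ε : ℤ) • restrictLocal ℤ ℤ inter_subset_left _ mN, fun u hu => ?_⟩
      rw [map_zsmul, restrictToPoint_restrictLocal_apply, hmN u hu.1, hβT u hu.2]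
  set ν := HomologicalOrientation.ofLocalFamily β hgen hcons with hν
  obtain ⟨wU, hwU, hloc⟩ := cU.exists_isRelFundamentalClass_of_interiorOrientation ν
  refine ⟨wU, hwU, fun x hx => ?_⟩
  -- the local class at `j x`: `val_* (β v) = val_* (νS v) = ambientFamily (j x) = j_* (pieceClass x)`
  set v : cU.Interior := ⟨S.j x, S.j_mem_interior hx⟩ with hv
  have hvS : v.val ∈ range S.j := ⟨x, rfl⟩
  have h1 := hloc v
  rw [HomologicalOrientation.ofLocalFamily_localClass, hβS v hvS, hνS,
    S.map_val_interiorFamily wS v] at h1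
  have h2 : S.ambientFamily wS v.val =
      relativeSingularHomology.map ℤ ℤ S.j (LocalFamily.mapsTo_compl_pt S.j_injective x)
        (m + 1 + 1) (S.pieceClass wS x) := S.ambientFamily_apply wS x
  rw [h2] at h1
  exact h1

end Gluing

/-! ### §2 The surgered null-cobordism, with local control over `W ∖ S` -/

section Surgery

variable {M : Type} [TopologicalSpace M] [ChartedSpace (EuclideanSpace ℝ (Fin (m + 1))) M]
  [IsManifold (𝓡 (m + 1)) ∞ M] [CompactSpace M]
  (c : NullCobordism (m + 1) M) {ι : Type} [Unique ι] {k l : ℕ}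
  (ν : FramedSphereFamily (𝓡∂ (m + 1 + 1)) c.W ι k (l + 1)) (hkl : k + l = m + 1)

omit [IsManifold (𝓡 (m + 1)) ∞ M] [CompactSpace M] in
/-- The gluing maps of the surgered manifold (topological content of
`isOpenGluingWith_surgered`; private copy). [cite: MilnorHCobordism1965, Def. 3.11 (PDF p. 17)] -/
private theorem surgered_gluing'' :
    IsOpenEmbedding (ν.glueData hkl).inl ∧
      IsOpenEmbedding ((ν.glueData hkl).inr ∘ SphereSurgery.toHandle ι k l hkl) ∧
      range (ν.glueData hkl).inl ∪ range ((ν.glueData hkl).inr ∘ SphereSurgery.toHandle ι k l hkl) =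
        univ ∧
      ∀ a b, (ν.glueData hkl).inl a = ((ν.glueData hkl).inr ∘ SphereSurgery.toHandle ι k l hkl) b ↔
        sphereFamilySurgeryRel ν a b := by
  have h := ν.isOpenGluingWith_surgered hkl
  exact ⟨⟨h.1.isEmbedding, h.2.1⟩, ⟨h.2.2.1.isEmbedding, h.2.2.2.1⟩, h.2.2.2.2.1, h.2.2.2.2.2⟩

omit [CompactSpace M] in
/-- The piece `W ∖ S ↪ χ(W, φ)` of a surgery is `inl` on points. [folklore] -/
@[simp] theorem surgeryPiece_j_apply (a : ↥ν.complement) :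
    (c.surgeryPiece ν hkl).j a = (ν.glueData hkl).inl a := rfl

omit [CompactSpace M] in
/-- The piece `W ∖ S ↪ χ(W, φ)` of a surgery is the open set `W ∖ S`. [folklore] -/
@[simp] theorem surgeryPiece_A : (c.surgeryPiece ν hkl).A = ν.complement := rfl

/-- **The surgered null-cobordism has a relative fundamental class agreeing with the given one on
`W ∖ S`** (`k ≥ 1`, `l ≥ 2`; Milnor 1965, §3 p. 21: `χ(W, φ)` carries the natural orientation,
that of `W ∖ S` extended over the handle; homological form, Hatcher 2002, p. 253): from a relative
fundamental class `w` of `(W, ∂W)`, a relative fundamental class `w'` of `(χ, ∂χ)` whose local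
class at `inl a`, `a ∈ W ∖ S` interior, is `inl_* (w|_a)` — both local classes come from the one
class `pieceClass w a` of `Hₘ₊₂(W ∖ S | a)`. [cite: MilnorHCobordism1965, §3 (PDF p. 21)] -/
theorem exists_isRelFundamentalClass_surgery_local (hk : 1 ≤ k) (hl : 2 ≤ l)
    {w : relativeSingularHomology ℤ ℤ c.W ((𝓡∂ (m + 1 + 1)).boundary c.W) (m + 1 + 1)}
    (hw : IsRelFundamentalClass ℤ ((𝓡∂ (m + 1 + 1)).boundary c.W) w) :
    ∃ w' : relativeSingularHomology ℤ ℤ (c.surgery ν hkl).W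
        ((𝓡∂ (m + 1 + 1)).boundary (c.surgery ν hkl).W) (m + 1 + 1),
      IsRelFundamentalClass ℤ ((𝓡∂ (m + 1 + 1)).boundary (c.surgery ν hkl).W) w' ∧
      ∀ (a : ↥ν.complement) (ha : (a : c.W) ∈ (𝓡∂ (m + 1 + 1)).interior c.W),
        relativeSingularHomology.toLocal ℤ ℤ ((𝓡∂ (m + 1 + 1)).boundary (c.surgery ν hkl).W)
            ⟨(c.surgeryPiece ν hkl).j a, (c.surgeryPiece ν hkl).j_mem_compl_boundary
              (c.not_mem_boundary_of_mem_interior ha)⟩ (m + 1 + 1) w' =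
          relativeSingularHomology.map ℤ ℤ (c.surgeryPiece ν hkl).j
            (LocalFamily.mapsTo_compl_pt (c.surgeryPiece ν hkl).j_injective a)
            (m + 1 + 1) ((c.surgeryPiece ν hkl).pieceClass w a) := by
  obtain ⟨hA, hB, hcov, hrel⟩ := surgered_gluing'' c ν hkl
  -- the handle is oriented: it is simply connected, Hausdorff and Euclidean-charted (`HandleE`)
  haveI : SimplyConnectedSpace ↥(ballTimesSphere ι k l) :=
    FramedSphereFamily.simplyConnectedSpace_ballTimesSphere ι k hl
  haveI : SimplyConnectedSpace (SphereSurgery.HandleE ι k l hkl) :=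
    inferInstanceAs (SimplyConnectedSpace ↥(ballTimesSphere ι k l))
  haveI : T2Space (SphereSurgery.HandleE ι k l hkl) :=
    inferInstanceAs (T2Space ↥(ballTimesSphere ι k l))
  obtain ⟨μH⟩ := isOrientableOver_of_simplyConnectedSpace ℤ (SphereSurgery.HandleE ι k l hkl)
    (n := m + 1 + 1)
  let μB : HomologicalOrientation ℤ ↥(ballTimesSphere ι k l) (m + 1 + 1) := μH
  haveI : LocallyCompactSpace ↥(ballTimesSphere ι k l) :=
    (ballTimesSphere ι k l).isOpen.locallyCompactSpace
  -- the overlap is nonempty and preconnected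
  obtain ⟨a₀, ha₀⟩ := FramedSphereFamily.exists_mem_gluedPart (ν := ν)
  have hjTint := c.surgeryHandleMap_mem_interior ν hkl
  have hsub : range (c.surgeryPiece ν hkl).j ∩ range (c.surgeryHandleMap ν hkl) ⊆
      (𝓡∂ (m + 1 + 1)).interior (c.surgery ν hkl).W := by
    rintro _ ⟨-, ⟨b, rfl⟩⟩; exact hjTint b
  have himage : (InteriorManifold.val : (c.surgery ν hkl).Interior → (c.surgery ν hkl).W) ''
      {v | v.val ∈ range (c.surgeryPiece ν hkl).j ∩ range (c.surgeryHandleMap ν hkl)} =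
      range (c.surgeryPiece ν hkl).j ∩ range (c.surgeryHandleMap ν hkl) := by
    ext z; constructor
    · rintro ⟨v, hv, rfl⟩; exact hv
    · intro hz; exact ⟨⟨z, hsub hz⟩, hz, rfl⟩
  have hpc : IsPathConnected (range (c.surgeryPiece ν hkl).j ∩ range (c.surgeryHandleMap ν hkl)) :=
    FramedSphereFamily.isPathConnected_range_inter_range hA hrel hk (by omega)
  have hne : {v : (c.surgery ν hkl).Interior |
      v.val ∈ range (c.surgeryPiece ν hkl).j ∩ range (c.surgeryHandleMap ν hkl)}.Nonempty :=
    ⟨⟨(ν.glueData hkl).inl a₀, hsub ⟨mem_range_self a₀,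
        FramedSphereFamily.apply_mem_range_jB hrel ha₀⟩⟩,
      ⟨mem_range_self a₀, FramedSphereFamily.apply_mem_range_jB hrel ha₀⟩⟩
  have hpre : IsPreconnected {v : (c.surgery ν hkl).Interior |
      v.val ∈ range (c.surgeryPiece ν hkl).j ∩ range (c.surgeryHandleMap ν hkl)} := by
    rw [← (InteriorManifold.isEmbedding_val (I := 𝓡∂ (m + 1 + 1))
      (M := (c.surgery ν hkl).W)).isInducing.isPreconnected_image, himage]
    exact hpc.isConnected.isPreconnected
  exact exists_isRelFundamentalClass_of_piece_of_orientation_local (c.surgeryPiece ν hkl)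
    (c.surgeryHandleMap ν hkl) hB hjTint μB hcov hne hpre hw

/-! ### §3 The oriented boundary is unchanged -/

omit [IsManifold (𝓡 (m + 1)) ∞ M] [CompactSpace M] in
/-- Boundary points of `W` lie in `W ∖ S` and are boundary points of the open submanifold
`W ∖ S`. [folklore] -/
theorem mem_boundary_complement_of_mem_boundary {x : c.W}
    (hx : x ∈ (𝓡∂ (m + 1 + 1)).boundary c.W) :
    (⟨x, ν.boundary_subset_complement hkl hx⟩ : ↥ν.complement) ∈
      (𝓡∂ (m + 1 + 1)).boundary (↥ν.complement) :=
  (ν.isBoundaryPoint_complement_iff ⟨x, ν.boundary_subset_complement hkl hx⟩).2 hx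

/-- **The restriction to the boundaries of an open embedding of pairs is an open embedding.**
[folklore] -/
theorem isOpenEmbedding_bdryRestrict {X' X : Type} [TopologicalSpace X'] [TopologicalSpace X]
    {B' : Set X'} {B : Set X} {j : X' → X} (hj : IsOpenEmbedding j)
    (hB : ∀ x', x' ∈ B' ↔ j x' ∈ B) : IsOpenEmbedding (bdryRestrict hj.continuous hB) := by
  refine ⟨⟨?_, ?_⟩, ?_⟩
  · -- inducing: the topology of `↥B'` is induced from `X`, and `j` induces
    have h1 : IsInducing (fun x : ↥B' => (bdryRestrict hj.continuous hB x : X)) :=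
      hj.isEmbedding.isInducing.comp IsInducing.subtypeVal
    exact IsInducing.of_comp (bdryRestrict hj.continuous hB).continuous continuous_subtype_val h1
  · intro x y hxy
    exact Subtype.ext (hj.injective (congrArg Subtype.val hxy))
  · have hr : range (bdryRestrict hj.continuous hB) = Subtype.val ⁻¹' range j := by
      ext ⟨z, hz⟩
      constructor
      · rintro ⟨x, hx⟩; exact ⟨x.1, congrArg Subtype.val hx⟩
      · rintro ⟨x', hx'⟩
        refine ⟨⟨x', (hB x').2 (hx' ▸ hz)⟩, Subtype.ext hx'⟩
    rw [hr]
    exact hj.isOpen_range.preimage continuous_subtype_val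

variable [T2Space M]

/-- **The boundary orientation is local: surgery in the interior does not change `bW` as an
oriented manifold** (Kervaire–Milnor 1963, §5; Kosinski 1993, X.2 p. 201: "surgeries … affect
neither the boundary of `M` nor its framing").  For relative fundamental classes `w` of
`(W, ∂W)` and `w'` of `(χ, ∂χ)` whose local classes agree over `W ∖ S` (the output of
`exists_isRelFundamentalClass_surgery_local`), if `∂w = incl_* [M]_μ` then the boundary
orientation of `∂w'` transported to `M` along `incl' = inl ∘ incl` is `μ`: at every boundary point
the local classes of `∂w`, `∂w'` come from one class (Hatcher 2002 p. 254, tree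
`toLocal_δ_eq_of_two_embeddings_manifold`), that class is `μ_y` moved into `∂(W ∖ S)`, and
orientations are compared pointwise. [cite: KervaireMilnorAnnals1963, §5; HatcherAT2002, §3.3 p. 254] -/
theorem boundaryOrientation_comap_eq_of_local
    {w : relativeSingularHomology ℤ ℤ c.W ((𝓡∂ (m + 1 + 1)).boundary c.W) (m + 1 + 1)}
    {w' : relativeSingularHomology ℤ ℤ (c.surgery ν hkl).W
        ((𝓡∂ (m + 1 + 1)).boundary (c.surgery ν hkl).W) (m + 1 + 1)}
    (hw' : IsRelFundamentalClass ℤ ((𝓡∂ (m + 1 + 1)).boundary (c.surgery ν hkl).W) w')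
    (hloc : ∀ (a : ↥ν.complement) (ha : (a : c.W) ∈ (𝓡∂ (m + 1 + 1)).interior c.W),
        relativeSingularHomology.toLocal ℤ ℤ ((𝓡∂ (m + 1 + 1)).boundary (c.surgery ν hkl).W)
            ⟨(c.surgeryPiece ν hkl).j a, (c.surgeryPiece ν hkl).j_mem_compl_boundary
              (c.not_mem_boundary_of_mem_interior ha)⟩ (m + 1 + 1) w' =
          relativeSingularHomology.map ℤ ℤ (c.surgeryPiece ν hkl).j
            (LocalFamily.mapsTo_compl_pt (c.surgeryPiece ν hkl).j_injective a)
            (m + 1 + 1) ((c.surgeryPiece ν hkl).pieceClass w a))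
    {μ : HomologicalOrientation ℤ M (m + 1)}
    (hδ : relativeSingularHomology.δ ℤ ℤ c.W ((𝓡∂ (m + 1 + 1)).boundary c.W) (m + 1) w =
        singularHomology.map ℤ ℤ (boundaryCorestrict (m + 1) c.inclMap c.incl_mem_boundary) (m + 1)
          μ.fundamentalClass) :
    (boundaryOrientation ℤ (Nat.succ_ne_zero m) hw').comap (c.surgery ν hkl).bdryHomeomorph = μ := by
  set S := c.surgeryPiece ν hkl with hS
  -- the two open embeddings of the pair `(W ∖ S, ∂(W ∖ S))`
  have hj₁ : IsOpenEmbedding (Subtype.val : ↥ν.complement → c.W) :=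
    ν.complement.2.isOpenEmbedding_subtypeVal
  have hj₂ : IsOpenEmbedding (S.j : ↥ν.complement → (c.surgery ν hkl).W) := S.isOpenEmbedding_j
  have hB₁ : ∀ x' : ↥ν.complement, x' ∈ (𝓡∂ (m + 1 + 1)).boundary (↥ν.complement) ↔
      (x' : c.W) ∈ (𝓡∂ (m + 1 + 1)).boundary c.W := fun x' => ν.isBoundaryPoint_complement_iff x'
  have hB₂ : ∀ x' : ↥ν.complement, x' ∈ (𝓡∂ (m + 1 + 1)).boundary (↥ν.complement) ↔
      S.j x' ∈ (𝓡∂ (m + 1 + 1)).boundary (c.surgery ν hkl).W :=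
    fun x' => (hB₁ x').trans (S.mem_boundary_iff x')
  -- [M]_μ restricts to `μ_y`
  have hfc : IsFundamentalClass μ μ.fundamentalClass :=
    HomologicalOrientation.isFundamentalClass_fundamentalClass_holds (R := ℤ) (X := M) (m + 1) μ
  haveI : Nonempty ↥ν.complement := by
    by_cases hM : Nonempty M
    · obtain ⟨y⟩ := hM; exact ⟨c.surgeryInclA ν hkl y⟩
    · obtain ⟨a, -⟩ := FramedSphereFamily.exists_mem_gluedPart (ν := ν); exact ⟨a⟩
  ext y : 2
  rw [HomologicalOrientation.comap_localClass, boundaryOrientation_localClass]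
  -- the boundary point `b = incl y` of `W ∖ S`
  have hyB : c.incl y ∈ (𝓡∂ (m + 1 + 1)).boundary c.W := c.incl_mem_boundary y
  have hb : c.surgeryInclA ν hkl y ∈ (𝓡∂ (m + 1 + 1)).boundary (↥ν.complement) :=
    c.mem_boundary_complement_of_mem_boundary ν hkl hyB
  -- locality of the boundary class along the two embeddings
  obtain ⟨β, h₁, h₂⟩ := toLocal_δ_eq_of_two_embeddings_manifold (R := ℤ) (M := ℤ) hb hj₁ hj₂
    hB₁ hB₂ w w' (fun h c' => by
      have hcB : (c'.center : c.W) ∉ (𝓡∂ (m + 1 + 1)).boundary c.W :=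
        fun h' => c'.center_not_mem_B ((hB₁ _).2 h')
      have hcint : (c'.center : c.W) ∈ (𝓡∂ (m + 1 + 1)).interior c.W := by
        rw [← ModelWithCorners.compl_boundary]; exact hcB
      refine ⟨S.pieceClass w c'.center, ?_, ?_⟩
      · exact (S.map_ι_pieceClass_of_mem w c'.center hcB).symm
      · exact hloc c'.center hcint)
  -- the map `g : M → ∂(W ∖ S)` through which `e` and `e'` factor
  let g : C(M, ↥((𝓡∂ (m + 1 + 1)).boundary (↥ν.complement))) :=
    ⟨fun y => ⟨c.surgeryInclA ν hkl y, c.mem_boundary_complement_of_mem_boundary ν hkl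
        (c.incl_mem_boundary y)⟩,
      ((c.isSmoothEmbedding_surgeryInclA ν hkl).isEmbedding.continuous).subtype_mk _⟩
  have hge : (bdryRestrict hj₁.continuous hB₁).comp g =
      (c.bdryHomeomorph : C(M, ↥((𝓡∂ (m + 1 + 1)).boundary c.W))) := by
    ext y : 1; exact Subtype.ext rfl
  have hge' : (bdryRestrict hj₂.continuous hB₂).comp g =
      ((c.surgery ν hkl).bdryHomeomorph : C(M, ↥((𝓡∂ (m + 1 + 1)).boundary (c.surgery ν hkl).W))) := by
    ext y : 1; exact Subtype.ext rfl
  have hg : MapsTo g ({y}ᶜ : Set M) ({(⟨c.surgeryInclA ν hkl y, hb⟩ : ↥((𝓡∂ (m + 1 + 1)).boundary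
      (↥ν.complement)))}ᶜ : Set _) := by
    intro y' hy' h'
    apply hy'
    have h'' := congrArg (fun z : ↥((𝓡∂ (m + 1 + 1)).boundary (↥ν.complement)) => ((z : ↥ν.complement) : c.W)) h'
    exact c.isSmoothEmbedding_incl.isEmbedding.injective h''
  have hcomp₁ : MapsTo ((bdryRestrict hj₁.continuous hB₁).comp g) ({y}ᶜ : Set M)
      ({(⟨(c.surgeryInclA ν hkl y : c.W), (hB₁ _).1 hb⟩ : ↥((𝓡∂ (m + 1 + 1)).boundary c.W))}ᶜ :
        Set _) :=
    fun y' hy' => (mapsTo_bdryRestrict hj₁.continuous hj₁.injective hB₁ hb) (hg hy')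
  have hcomp₂ : MapsTo ((bdryRestrict hj₂.continuous hB₂).comp g) ({y}ᶜ : Set M)
      ({(⟨S.j (c.surgeryInclA ν hkl y), (hB₂ _).1 hb⟩ :
        ↥((𝓡∂ (m + 1 + 1)).boundary (c.surgery ν hkl).W))}ᶜ : Set _) :=
    fun y' hy' => (mapsTo_bdryRestrict hj₂.continuous hj₂.injective hB₂ hb) (hg hy')
  -- (D) the local class of `∂w` at `incl y` is `e_* μ_y`
  have hD : singularHomology.toLocal ℤ ℤ (c.bdryHomeomorph y) (m + 1)
      (relativeSingularHomology.δ ℤ ℤ c.W ((𝓡∂ (m + 1 + 1)).boundary c.W) (m + 1) w) =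
      (localHomology.mapIso ℤ ℤ c.bdryHomeomorph y (m + 1)).hom (μ.localClass y) := by
    rw [hδ, boundaryCorestrict_inclMap_eq, ← hfc y]
    exact singularHomology.toLocal_map_apply' ℤ ℤ _ y _ _ (m + 1) _
  -- (E) hence `β = g_* μ_y`
  have hE : β = relativeSingularHomology.map ℤ ℤ g hg (m + 1) (μ.localClass y) := by
    haveI := localHomology.isIso_map_of_isOpenEmbedding_of_eq ℤ ℤ
      (bdryRestrict hj₁.continuous hB₁) (isOpenEmbedding_bdryRestrict hj₁ hB₁)
      ⟨c.surgeryInclA ν hkl y, hb⟩ rfl (m + 1)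
    apply (ModuleCat.mono_iff_injective (relativeSingularHomology.map ℤ ℤ
      (bdryRestrict hj₁.continuous hB₁) (LocalFamily.mapsTo_compl_pt
        (isOpenEmbedding_bdryRestrict hj₁ hB₁).injective ⟨c.surgeryInclA ν hkl y, hb⟩)
        (m + 1))).1 inferInstance
    change singularHomology.toLocal ℤ ℤ (c.bdryHomeomorph y) (m + 1)
      (relativeSingularHomology.δ ℤ ℤ c.W ((𝓡∂ (m + 1 + 1)).boundary c.W) (m + 1) w) = _ at h₁
    change relativeSingularHomology.map ℤ ℤ (bdryRestrict hj₁.continuous hB₁)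
        (mapsTo_bdryRestrict hj₁.continuous hj₁.injective hB₁ hb) (m + 1) β = _
    rw [← h₁, hD, ← ModuleCat.comp_apply, ← relativeSingularHomology.map_comp]
    exact (ConcreteCategory.congr_hom (relativeSingularHomology.map_congr_left ℤ ℤ hge
      hcomp₁ _ (m + 1)) (μ.localClass y)).symm
  -- (F) the local class of `∂w'` at `incl' y` is `e'_* μ_y`
  change (localHomology.mapIso ℤ ℤ (c.surgery ν hkl).bdryHomeomorph y (m + 1)).inv
      (singularHomology.toLocal ℤ ℤ _ (m + 1) (relativeSingularHomology.δ ℤ ℤ (c.surgery ν hkl).W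
        ((𝓡∂ (m + 1 + 1)).boundary (c.surgery ν hkl).W) (m + 1) w')) = _ at ⊢
  change singularHomology.toLocal ℤ ℤ ((c.surgery ν hkl).bdryHomeomorph y) (m + 1)
      (relativeSingularHomology.δ ℤ ℤ (c.surgery ν hkl).W
        ((𝓡∂ (m + 1 + 1)).boundary (c.surgery ν hkl).W) (m + 1) w') = _ at h₂
  rw [h₂, hE, ← ModuleCat.comp_apply, ← relativeSingularHomology.map_comp]
  have key : relativeSingularHomology.map ℤ ℤ ((bdryRestrict hj₂.continuous hB₂).comp g) hcomp₂
      (m + 1) = (localHomology.mapIso ℤ ℤ (c.surgery ν hkl).bdryHomeomorph y (m + 1)).hom :=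
    relativeSingularHomology.map_congr_left ℤ ℤ hge' hcomp₂ _ (m + 1)
  refine Eq.trans ?_ (ConcreteCategory.congr_hom
    (localHomology.mapIso ℤ ℤ (c.surgery ν hkl).bdryHomeomorph y (m + 1)).hom_inv_id
      (μ.localClass y))
  exact congrArg ((localHomology.mapIso ℤ ℤ (c.surgery ν hkl).bdryHomeomorph y (m + 1)).inv)
    (ConcreteCategory.congr_hom key (μ.localClass y))

/-- **Oriented-boundary data pass through a surgery, with a locally matching fundamental class**
(Kervaire–Milnor 1963, §5–§7: `χ(M, φ)` is oriented compatibly with `M ∖ S` and `bχ = bM`;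
Milnor 1965, §3 p. 21).  From `(M, μ) = bW` (`c.IsOrientedBy μ μ'`, `M` connected nonempty,
`k ≥ 1`, `l ≥ 2`): relative fundamental classes `w` of `(W, ∂W)` and `w'` of `(χ, ∂χ)` with
`[Ŵ]_{μ'} = c_w`, an orientation `μ''` of the closed model of `χ` with `[χ̂]_{μ''} = c_{w'}` and
`(M, μ) = bχ` (`(c.surgery ν hkl).IsOrientedBy μ μ''`), and the local agreement
`w'|_{inl a} = inl_* (w|_a)` over `W ∖ S`. [cite: KervaireMilnorAnnals1963, §5 and §7 (Thm. 7.5)] -/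
theorem exists_isOrientedBy_surgery_local [ConnectedSpace M] [Nonempty M] (hk : 1 ≤ k) (hl : 2 ≤ l)
    {μ : HomologicalOrientation ℤ M (m + 1)}
    {μ' : HomologicalOrientation ℤ (ClosedModel (m + 1) c.W) (m + 1 + 1)}
    (h : c.IsOrientedBy μ μ') :
    ∃ (w : relativeSingularHomology ℤ ℤ c.W ((𝓡∂ (m + 1 + 1)).boundary c.W) (m + 1 + 1))
      (w' : relativeSingularHomology ℤ ℤ (c.surgery ν hkl).W
        ((𝓡∂ (m + 1 + 1)).boundary (c.surgery ν hkl).W) (m + 1 + 1))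
      (μ'' : HomologicalOrientation ℤ (ClosedModel (m + 1) (c.surgery ν hkl).W) (m + 1 + 1)),
      IsRelFundamentalClass ℤ ((𝓡∂ (m + 1 + 1)).boundary c.W) w ∧
      IsRelFundamentalClass ℤ ((𝓡∂ (m + 1 + 1)).boundary (c.surgery ν hkl).W) w' ∧
      μ'.fundamentalClass = c.closedModelClass ℤ ℤ (Nat.le_add_left 1 m) w ∧
      μ''.fundamentalClass = (c.surgery ν hkl).closedModelClass ℤ ℤ (Nat.le_add_left 1 m) w' ∧
      (c.surgery ν hkl).IsOrientedBy μ μ'' ∧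
      ∀ (a : ↥ν.complement) (ha : (a : c.W) ∈ (𝓡∂ (m + 1 + 1)).interior c.W),
        relativeSingularHomology.toLocal ℤ ℤ ((𝓡∂ (m + 1 + 1)).boundary (c.surgery ν hkl).W)
            ⟨(c.surgeryPiece ν hkl).j a, (c.surgeryPiece ν hkl).j_mem_compl_boundary
              (c.not_mem_boundary_of_mem_interior ha)⟩ (m + 1 + 1) w' =
          relativeSingularHomology.map ℤ ℤ (c.surgeryPiece ν hkl).j
            (LocalFamily.mapsTo_compl_pt (c.surgeryPiece ν hkl).j_injective a)
            (m + 1 + 1) ((c.surgeryPiece ν hkl).pieceClass w a) := by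
  obtain ⟨w, hw, hμ'w, hδ⟩ := IsOrientedBy.exists_isRelFundamentalClass c (Nat.le_add_left 1 m) h
  obtain ⟨w', hw', hloc⟩ := c.exists_isRelFundamentalClass_surgery_local ν hkl hk hl hw
  obtain ⟨κ'⟩ := BoundaryData.nonempty_collar_of_compactSpace m (c.surgery ν hkl).W
    (c.surgery ν hkl).boundaryData
  refine ⟨w, w', (c.surgery ν hkl).closedModelOrientation κ' ℤ (Nat.le_add_left 1 m) hw', hw, hw',
    hμ'w, (c.surgery ν hkl).fundamentalClass_closedModelOrientation κ' ℤ _ hw', ?_, hloc⟩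
  have hob := (c.surgery ν hkl).isOrientedBy_closedModelOrientation κ' (Nat.le_add_left 1 m) hw'
  rwa [c.boundaryOrientation_comap_eq_of_local ν hkl hw' hloc hδ] at hob

end Surgery

end NullCobordism

end Literature.Topology.FourManifolds
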